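import Mathlib

/-!
# Crux `IntegralOrbits.IntDetQP` (stmt-ValiantsHypothesis-7677), line `birth` —
# registered stub `stub_regularPencilDet` (L2): the regular pencil determinant

**Claim.** Let `M : ι → M_m(ℂ)` be a matrix tuple, `b : Fin m × Fin m → M_m(ℂ)` a linearly
independent family (hence a basis of `M_m(ℂ)`), and `Cv v` the coordinate matrix of LEFT
multiplication by `M v` in the basis `b`, i.e. `M v * b j = Σ_i Cv v i j • b i`.  Then the generic
pencils have determinants related by
`det (X₀·1 + Σ_v X_v Cv_v) = det (X₀·1 + Σ_v X_v M_v)^m`.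

**Proof.** Flatten `A ∈ M_m(ℂ)` to the vector `(a, c) ↦ A a c` indexed by `Fin m × Fin m`.  In these
coordinates left multiplication by `B` is the block diagonal matrix
`Matrix.blockDiagonal (fun _ : Fin m => B)` (entry `((a,c),(x,c')) = [c = c'] B a x`), and the
coordinate matrix `P (a,c) j := b j a c` (columns = flattened `b j`) satisfies
`blockDiagonal (fun _ => M v) * P = P * Cv v` (this is the hypothesis read entrywise).  The
columns of `P` are the images of the linearly independent `b j` under the flattening
isomorphism, so `P` is invertible (`Matrix.linearIndependent_cols_iff_isUnit`), hence so is
`det (P.map C)` over the polynomial ring.  Mapping the intertwining relation through `C` and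
taking the `X`-linear combination gives `pencil(blockDiagonal M) * P.map C = P.map C * pencil(Cv)`,
so the two pencils have the same determinant; finally
`pencil(blockDiagonal M) = blockDiagonal (fun _ => pencil M)` entrywise and
`Matrix.det_blockDiagonal` gives the `m`-th power.  The degenerate case `m = 0` needs no separate
treatment (all index types are empty, `det = 1 = 1 ^ 0`).

Unconditional (axioms `propext`, `Classical.choice`, `Quot.sound`); Mathlib only.  The statement
is the change-of-basis invariance of the determinant together with the block structure of the
left-regular representation of `M_m(ℂ)`; folklore.
-/

set_option linter.dupNamespace false -- single-conjunct summit

namespace Summit.ValiantsHypothesis.ValiantsHypothesis.Theorems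

namespace IntegralOrbitsIntDetQPRegularPencilDet

open MvPolynomial Matrix

/-- Conjugate matrices have equal determinants, in the form we need: if `X * P = P * Y` and
`det P` is a unit then `det X = det Y` (no inverse of `P` is formed). [folklore] -/
theorem det_eq_of_conj {R : Type*} [CommRing R] {n : Type*} [Fintype n] [DecidableEq n]
    {X Y P : Matrix n n R} (hP : IsUnit P.det) (h : X * P = P * Y) : X.det = Y.det := by
  refine hP.mul_left_cancel ?_
  calc P.det * X.det = (X * P).det := by rw [det_mul, mul_comm]
    _ = (P * Y).det := by rw [h]
    _ = P.det * Y.det := det_mul _ _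

/-- The generic pencil of a constant block diagonal tuple is the constant block diagonal matrix of
the generic pencil: `x₀ • 1 + Σ_v x_v • blockDiagonal (fun _ => A v) =
blockDiagonal (fun _ => x₀ • 1 + Σ_v x_v • A v)`. [folklore] -/
theorem pencil_blockDiagonal {R : Type*} [CommSemiring R] {κ n o : Type*} [Fintype κ]
    [DecidableEq n] [DecidableEq o] (x₀ : R) (x : κ → R) (A : κ → Matrix n n R) :
    x₀ • (1 : Matrix (n × o) (n × o) R) + ∑ v, x v • blockDiagonal (fun _ : o => A v) =
      blockDiagonal fun _ : o => x₀ • (1 : Matrix n n R) + ∑ v, x v • A v := by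
  ext ⟨a, c⟩ ⟨a', c'⟩
  simp only [Matrix.add_apply, Matrix.smul_apply, Matrix.sum_apply, blockDiagonal_apply',
    Matrix.one_apply, Prod.mk.injEq, smul_eq_mul]
  by_cases h : c = c'
  · subst h
    simp
  · simp [h]

/-- A constant block diagonal matrix commutes with entrywise maps fixing `0`. [folklore] -/
theorem blockDiagonal_const_map {α β : Type*} [Zero α] [Zero β] {n o : Type*} [DecidableEq o]
    (A : Matrix n n α) (f : α → β) (hf : f 0 = 0) :
    (blockDiagonal fun _ : o => A).map f = blockDiagonal fun _ : o => A.map f :=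
  blockDiagonal_map _ f hf

variable {m : ℕ}

/-- Entries of `blockDiagonal (fun _ => M) * P` for the coordinate matrix `P (a,c) j = b j a c`:
they are the entries `(M * b j) a c`. [folklore] -/
theorem blockDiagonal_mul_coord_apply (M : Matrix (Fin m) (Fin m) ℂ)
    (b : Fin m × Fin m → Matrix (Fin m) (Fin m) ℂ) (a c : Fin m) (j : Fin m × Fin m) :
    (blockDiagonal (fun _ : Fin m => M) *
        Matrix.of (fun ac j : Fin m × Fin m => b j ac.1 ac.2)) (a, c) j = (M * b j) a c := by
  rw [Matrix.mul_apply, Matrix.mul_apply, Fintype.sum_prod_type]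
  refine Finset.sum_congr rfl fun x _ => ?_
  simp only [blockDiagonal_apply', Matrix.of_apply, ite_mul, zero_mul, Finset.sum_ite_eq,
    Finset.mem_univ, if_true]

/-- The intertwining relation: in flattened coordinates, left multiplication by `M`
(`= blockDiagonal (fun _ => M)`) times the coordinate matrix `P` of the family `b` equals `P`
times the coordinate matrix `Cv` of left multiplication in the basis `b`. [folklore] -/
theorem blockDiagonal_mul_coord (M : Matrix (Fin m) (Fin m) ℂ)
    (b : Fin m × Fin m → Matrix (Fin m) (Fin m) ℂ) (Cv : Matrix (Fin m × Fin m) (Fin m × Fin m) ℂ)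
    (h : ∀ j, M * b j = ∑ i, Cv i j • b i) :
    blockDiagonal (fun _ : Fin m => M) * Matrix.of (fun ac j : Fin m × Fin m => b j ac.1 ac.2) =
      Matrix.of (fun ac j : Fin m × Fin m => b j ac.1 ac.2) * Cv := by
  ext ⟨a, c⟩ j
  rw [blockDiagonal_mul_coord_apply, h j, Matrix.mul_apply, Matrix.sum_apply]
  simp only [Matrix.smul_apply, smul_eq_mul, Matrix.of_apply]
  exact Finset.sum_congr rfl fun i _ => mul_comm _ _

/-- The coordinate matrix `P (a,c) j = b j a c` of a linearly independent family
`b : Fin m × Fin m → M_m(ℂ)` is invertible: its columns are the flattened `b j`, still linearly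
independent. [folklore] -/
theorem isUnit_coordMatrix {b : Fin m × Fin m → Matrix (Fin m) (Fin m) ℂ}
    (hb : LinearIndependent ℂ b) :
    IsUnit (Matrix.of fun ac j : Fin m × Fin m => b j ac.1 ac.2) := by
  refine Matrix.linearIndependent_cols_iff_isUnit.mp ?_
  rw [Fintype.linearIndependent_iff]
  intro g hg j
  refine Fintype.linearIndependent_iff.mp hb g ?_ j
  ext a c
  have hac := congr_fun hg (a, c)
  simp only [Finset.sum_apply, Pi.smul_apply, Matrix.col_apply, Matrix.of_apply, smul_eq_mul,
    Pi.zero_apply] at hac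
  simpa only [Matrix.sum_apply, Matrix.smul_apply, smul_eq_mul, Matrix.zero_apply] using hac

end IntegralOrbitsIntDetQPRegularPencilDet

open MvPolynomial Matrix IntegralOrbitsIntDetQPRegularPencilDet in
/-- **Regular pencil determinant** (registered stub `stub_regularPencilDet`, L2 of the line): if
`b` is a linearly independent family in `M_m(ℂ)` indexed by `Fin m × Fin m` and `Cv v` is the
matrix of left multiplication by `M v` in the basis `b` (`M v * b j = Σ_i Cv v i j • b i`), then
`det (X₀·1 + Σ_v X_v Cv_v) = det (X₀·1 + Σ_v X_v M_v)^m` (change of basis to the flattened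
standard coordinates, where left multiplication is block diagonal with `m` copies of `M v`).
[folklore] -/
theorem stub_regularPencilDet :
    ∀ (ι : Type) [Fintype ι] [DecidableEq ι] (m : ℕ) (M : ι → Matrix (Fin m) (Fin m) ℂ)
      (b : Fin m × Fin m → Matrix (Fin m) (Fin m) ℂ)
      (Cv : ι → Matrix (Fin m × Fin m) (Fin m × Fin m) ℂ),
      LinearIndependent ℂ b →
      (∀ v j, M v * b j = ∑ i, Cv v i j • b i) →
      ((MvPolynomial.X none : MvPolynomial (Option ι) ℂ) •
            (1 : Matrix (Fin m × Fin m) (Fin m × Fin m) (MvPolynomial (Option ι) ℂ)) +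
          ∑ v : ι, (MvPolynomial.X (some v) : MvPolynomial (Option ι) ℂ) •
            (Cv v).map (MvPolynomial.C : ℂ →+* MvPolynomial (Option ι) ℂ)).det =
        (((MvPolynomial.X none : MvPolynomial (Option ι) ℂ) •
              (1 : Matrix (Fin m) (Fin m) (MvPolynomial (Option ι) ℂ)) +
            ∑ v : ι, (MvPolynomial.X (some v) : MvPolynomial (Option ι) ℂ) •
              (M v).map (MvPolynomial.C : ℂ →+* MvPolynomial (Option ι) ℂ)).det) ^ m := by
  intro ι _ _ m M b Cv hb hmul
  -- the coordinate matrix of `b` (columns = flattened `b j`) and its image over the polynomials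
  have hPdet : IsUnit ((Matrix.of fun ac j : Fin m × Fin m => b j ac.1 ac.2).map
      (MvPolynomial.C : ℂ →+* MvPolynomial (Option ι) ℂ)).det :=
    (Matrix.isUnit_iff_isUnit_det _).mp
      ((isUnit_coordMatrix hb).map (MvPolynomial.C : ℂ →+* MvPolynomial (Option ι) ℂ).mapMatrix)
  -- the intertwining relation, mapped to the polynomial ring
  have hrel : ∀ v, blockDiagonal (fun _ : Fin m => (M v).map
      (MvPolynomial.C : ℂ →+* MvPolynomial (Option ι) ℂ)) *
        (Matrix.of fun ac j : Fin m × Fin m => b j ac.1 ac.2).map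
          (MvPolynomial.C : ℂ →+* MvPolynomial (Option ι) ℂ) =
      (Matrix.of fun ac j : Fin m × Fin m => b j ac.1 ac.2).map
          (MvPolynomial.C : ℂ →+* MvPolynomial (Option ι) ℂ) *
        (Cv v).map (MvPolynomial.C : ℂ →+* MvPolynomial (Option ι) ℂ) := fun v => by
    rw [← blockDiagonal_const_map _ _ (map_zero _), ← Matrix.map_mul,
      blockDiagonal_mul_coord (M v) b (Cv v) (hmul v), Matrix.map_mul]
  -- hence the two pencils are intertwined by `P.map C`
  have hconj : ((X none : MvPolynomial (Option ι) ℂ) •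
        (1 : Matrix (Fin m × Fin m) (Fin m × Fin m) (MvPolynomial (Option ι) ℂ)) +
      ∑ v : ι, (X (some v) : MvPolynomial (Option ι) ℂ) •
        blockDiagonal (fun _ : Fin m => (M v).map
          (MvPolynomial.C : ℂ →+* MvPolynomial (Option ι) ℂ))) *
      (Matrix.of fun ac j : Fin m × Fin m => b j ac.1 ac.2).map
        (MvPolynomial.C : ℂ →+* MvPolynomial (Option ι) ℂ) =
    (Matrix.of fun ac j : Fin m × Fin m => b j ac.1 ac.2).map
        (MvPolynomial.C : ℂ →+* MvPolynomial (Option ι) ℂ) *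
      ((X none : MvPolynomial (Option ι) ℂ) •
          (1 : Matrix (Fin m × Fin m) (Fin m × Fin m) (MvPolynomial (Option ι) ℂ)) +
        ∑ v : ι, (X (some v) : MvPolynomial (Option ι) ℂ) •
          (Cv v).map (MvPolynomial.C : ℂ →+* MvPolynomial (Option ι) ℂ)) := by
    simp only [add_mul, mul_add, Finset.sum_mul, Finset.mul_sum, Matrix.smul_mul,
      Matrix.mul_smul, Matrix.one_mul, Matrix.mul_one, hrel]
  -- and the block diagonal pencil is the block diagonal of the small pencil
  have hblock : (X none : MvPolynomial (Option ι) ℂ) •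
        (1 : Matrix (Fin m × Fin m) (Fin m × Fin m) (MvPolynomial (Option ι) ℂ)) +
      ∑ v : ι, (X (some v) : MvPolynomial (Option ι) ℂ) •
        blockDiagonal (fun _ : Fin m => (M v).map
          (MvPolynomial.C : ℂ →+* MvPolynomial (Option ι) ℂ)) =
    blockDiagonal fun _ : Fin m => (X none : MvPolynomial (Option ι) ℂ) •
        (1 : Matrix (Fin m) (Fin m) (MvPolynomial (Option ι) ℂ)) +
      ∑ v : ι, (X (some v) : MvPolynomial (Option ι) ℂ) •
        (M v).map (MvPolynomial.C : ℂ →+* MvPolynomial (Option ι) ℂ) :=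
    pencil_blockDiagonal _ _ _
  refine (det_eq_of_conj hPdet hconj).symm.trans ?_
  rw [hblock, det_blockDiagonal, Finset.prod_const, Finset.card_univ, Fintype.card_fin]

end Summit.ValiantsHypothesis.ValiantsHypothesis.Theorems
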